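/-
Copyright (c) 2026. All rights reserved.
Released under Apache 2.0 license as described in the file LICENSE.
Authors: abc-iut cell, cone prover seat abc-iut-w6-d036 (wave 6, gen 3).
-/
import Mathlib.CategoryTheory.Types.Basic
import Mathlib.CategoryTheory.Functor.Const
import Mathlib.CategoryTheory.Sums.Basic
import Literature.AnabelianGeometry.AbsoluteAnabelian.LogFrobeniusMonoAnalyticization
import HarnessLib

/-!
# [AbsTopIII] Corollary 5.10, preamble: the mono-analyticization homotopies — kernel calibration of the interface add-on (inhabited at the diagonal setting, EMPTY at a twisted one)

S. Mochizuki, *Topics in absolute anabelian geometry III: global reconstruction algorithms*,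
J. Math. Sci. Univ. Tokyo 22 (2015) 939–1156 [MochizukiAbsTopIII2015]; locators `p.N` = pages of the author's
manuscript (`paper:url-5493eb38cbb7`): Cor 5.10 preamble p. 146 ("we have a natural mono-analyticization morphism
[consisting of arrows between corresponding vertices belonging to rows indexed by the same integer!] of diagrams of
categories `D•_{≥3} → D⊢` … We shall refer to the various isomorphisms between composites of functors inherent in the
definition of the mono-analyticization morphism `D•_{≥3} → D⊢` … as mono-analyticization homotopies"), Cor 5.10 (iv)(a)
p. 147, Def 5.6 (iii), (iv) pp. 135–136 (the 1-commutative squares whose vertical arrows are mono-analyticization functors).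

PROOF-ONLY companion of `LogFrobeniusMonoAnalyticization.lean` (abc-iut-L4-t3: the interface ADD-ON
`LogFrobeniusSetting.MonoAnalyticizationHomotopies` — the rows 4 → 5 and 6 → 7 homotopies of the morphism `D•_{≥3} → D⊢`
that the frozen `LogFrobeniusSetting` does not record — and `cor510MonoCores_holds`, Cor 5.10 (iv)(a) over it), written as
the kernel half of this seat's DEFS second read of that file.  Two kernel facts about the TYPING (no arithmetic content):

* `exists_nonempty_monoAnalyticizationHomotopies` — NON-VACUITY: at the diagonal setting on a large
  category `C` (every row `C`, every structure functor `𝟭 C`, every equivalence `refl`, every 2-cell an identity) both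
  missing squares commute strictly, the add-on is inhabited by identity isomorphisms, and Cor 5.10 (iv)(a) follows
  there THROUGH `cor510MonoCores_holds` (re-deriving abc-iut-w4-d095's calibration `exists_cor510MonoCores`,
  `LogFrobeniusMonoCoresCalibration.lean`, which fed abc-iut-L4-t15's `cor510MonoCores_of` directly);
* `exists_isEmpty_monoAnalyticizationHomotopies` — INDEPENDENCE: the same diagonal setting on `Type u` twisted ONLY at
  the mono-analyticization `ℰ• → ℰ⊢ := ` the constant functor at the empty type still satisfies every law of the frozen
  interface (none of `logIsoId`, `logOver`, `lamOver`, `iota`, `ηAn`, `monoHomotopy` mentions `monoAn`), yet over a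
  nonempty index set it admits NO mono-analyticization homotopies (the rows 4 → 5 square at a place `v` would be an
  isomorphism `𝟭 ≅ const ∅`, giving a map `PUnit → PEmpty`).  So the add-on is a genuine datum — NOT a consequence of
  `LogFrobeniusSetting` — confirming in the kernel the typer's diagnosis "printed data omitted by the frozen interface"
  and that the two homotopy inputs `hN`, `hκ` of `cor510MonoCores_of` cannot be dropped.

* `exists_monoAnalyticizationHomotopies_not_rmk522` — PRECISION of the rows 6 → 7 datum: the add-on field `anToE`
  (the Def 3.5 (v) edge isomorphism over `An⊢[𝒩⊢⊞] → ℰ⊢`) does NOT force the Rmk 5.2.2 identification `κ₂ ≅ κ_{An•}⁻¹` of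
  the two equivalences `ℰ• ≃ An•[𝒳] ≃ ℰ•`: on the sum category `Type u ⊕ Type u` with `κ₂ :=` the swap self-equivalence and
  the mono-analyticization functors into `ℰ⊢` constant, the add-on is inhabited while `κ₂.functor ≅ κ_{An•}.inverse` is
  empty (a component would be a morphism `inr ⋆ ⟶ inl ⋆`).  Consumers needing Rmk 5.2.2 must take it as a separate input.

Refereed pre-IUT anabelian geometry; nothing here bears on [IUTchIII] Cor. 3.12; calibration of typed statements only;
OUR kernel check, no side taken; typed ≠ proved.
-/

set_option autoImplicit false

universe u

open CategoryTheory

namespace Literature.AnabelianGeometry.AbsoluteAnabelian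

namespace LogFrobeniusSetting

variable (Vmod : Type u) (isArc : Vmod → Bool)

/-- `Λ_ν ∘ 𝟭 = 𝟭` for `log•_{T,T} = 𝟭` (the typing of `ι⊞_{v,ε}` at a diagonal setting).
[cite: MochizukiAbsTopIII2015, Def 5.4 (vii) p. 128] -/
private theorem frobeniusTwist_id_comp_id₃ {C : Type (u + 1)} [Category.{u} C] (b : Bool) :
    frobeniusTwist (𝟭 C) b ⋙ 𝟭 C = 𝟭 C := by
  cases b <;> rfl

/-- **NON-VACUITY of the add-on, and Cor 5.10 (iv)(a) through it.**  At the diagonal log-Frobenius setting on a large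
category `C` (every row of `D•⊢` is `C`, every structure functor — in particular every mono-analyticization functor — is
`𝟭 C`, every equivalence `refl`, every 2-cell an identity) the rows 4 → 5 square `𝒩_v → 𝒩⊢_v → ℰ⊢ ≅ 𝒩_v → ℰ• → ℰ⊢` and the
rows 6 → 7 square `An•[𝒳] → An⊢[𝒩⊢⊞] → ℰ⊢ ≅ An•[𝒳] → ℰ• → ℰ⊢` commute strictly, so the mono-analyticization homotopies exist
(identity isomorphisms); over a nonempty index set abc-iut-L4-t3's `cor510MonoCores_holds` then makes `ℰ⊢`, `An⊢[𝒩⊢⊞]`, `ℰ⊢`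
cores of `D•⊢_{≤n-1} ∪ D•_{≤n}`, `n = 5, 6, 7` (same conclusion as abc-iut-w4-d095's `exists_cor510MonoCores`, reached through
the add-on API).  DEGENERATE witness, no arithmetic content. [cite: MochizukiAbsTopIII2015, Cor 5.10 (iv)(a) p. 147] -/
theorem exists_nonempty_monoAnalyticizationHomotopies (C : Type (u + 1)) [Category.{u} C] :
    ∃ L : LogFrobeniusSetting Vmod isArc, (L.E = C ∧ L.Emono = C ∧ (∀ v, L.N v = C ∧ L.Nmono v = C)) ∧
      Nonempty L.MonoAnalyticizationHomotopies ∧ (Nonempty Vmod → L.Cor510MonoCores) := by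
  let L₀ : LogFrobeniusSetting Vmod isArc :=
    { X := C
      E := C
      proj := 𝟭 C
      log := 𝟭 C
      logIsoId := Iso.refl _
      logOver := Iso.refl _
      Nplus := fun _ => C
      N := fun _ => C
      forget := fun _ => 𝟭 C
      toE := fun _ => 𝟭 C
      lam := fun _ _ => 𝟭 C
      lamOver := fun _ _ => Iso.refl _
      lam_spaceLink_eq_postLog := fun _ => rfl
      iota := fun _ ν₁ _ _ => eqToHom (frobeniusTwist_id_comp_id₃ ν₁.isPostLog)
      An := C
      κAn := CategoryTheory.Equivalence.refl
      φAn := 𝟭 C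
      φAn_isEquivalence := inferInstance
      ηAn := Iso.refl _
      κAn₂ := CategoryTheory.Equivalence.refl
      Emono := C
      monoAn := 𝟭 C
      NmonoPlus := fun _ => C
      Nmono := fun _ => C
      forgetMono := fun _ => 𝟭 C
      toEmono := fun _ => 𝟭 C
      monoNplus := fun _ => 𝟭 C
      monoN := fun _ => 𝟭 C
      monoHomotopy := fun _ => Iso.refl _
      AnMono := C
      κAnMono := CategoryTheory.Equivalence.refl
      ψAnMono := fun _ _ => 𝟭 C }
  let M₀ : L₀.MonoAnalyticizationHomotopies := { toE := fun _ => Iso.refl _, anToE := Iso.refl _ }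
  exact ⟨L₀, ⟨rfl, rfl, fun _ => ⟨rfl, rfl⟩⟩, ⟨M₀⟩, fun _ => cor510MonoCores_holds M₀⟩

/-- **INDEPENDENCE of the add-on from the frozen interface.**  Over a nonempty index set, the diagonal setting on
`Type u` twisted ONLY at the mono-analyticization `ℰ• → ℰ⊢ :=` the constant functor at the empty type satisfies every
law of `LogFrobeniusSetting` (none of `logIsoId`, `logOver`, `lamOver`, `ι⊞`, `η_{An•}`, the rows 3 → 4 homotopy mentions
`ℰ• → ℰ⊢`) yet admits NO mono-analyticization homotopies: the rows 4 → 5 homotopy at a place `v` would be an isomorphism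
`𝟭 ⋙ 𝟭 ≅ 𝟭 ⋙ const ∅` of endofunctors of `Type u`, whose component at `PUnit` is a map `PUnit → PEmpty`.  Hence the
homotopies are printed DATA that cannot be derived from the interface's fields, and the inputs `hN`, `hκ` of
abc-iut-L4-t15's `cor510MonoCores_of` are not redundant. [cite: MochizukiAbsTopIII2015, Cor 5.10 p. 146] -/
theorem exists_isEmpty_monoAnalyticizationHomotopies [Nonempty Vmod] :
    ∃ L : LogFrobeniusSetting Vmod isArc, (L.E = Type u ∧ L.Emono = Type u) ∧
      IsEmpty L.MonoAnalyticizationHomotopies := by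
  let L₀ : LogFrobeniusSetting Vmod isArc :=
    { X := Type u
      E := Type u
      proj := 𝟭 (Type u)
      log := 𝟭 (Type u)
      logIsoId := Iso.refl _
      logOver := Iso.refl _
      Nplus := fun _ => Type u
      N := fun _ => Type u
      forget := fun _ => 𝟭 (Type u)
      toE := fun _ => 𝟭 (Type u)
      lam := fun _ _ => 𝟭 (Type u)
      lamOver := fun _ _ => Iso.refl _
      lam_spaceLink_eq_postLog := fun _ => rfl
      iota := fun _ ν₁ _ _ => eqToHom (frobeniusTwist_id_comp_id₃ ν₁.isPostLog)
      An := Type u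
      κAn := CategoryTheory.Equivalence.refl
      φAn := 𝟭 (Type u)
      φAn_isEquivalence := inferInstance
      ηAn := Iso.refl _
      κAn₂ := CategoryTheory.Equivalence.refl
      Emono := Type u
      monoAn := (Functor.const (Type u)).obj (PEmpty : Type u)
      NmonoPlus := fun _ => Type u
      Nmono := fun _ => Type u
      forgetMono := fun _ => 𝟭 (Type u)
      toEmono := fun _ => 𝟭 (Type u)
      monoNplus := fun _ => 𝟭 (Type u)
      monoN := fun _ => 𝟭 (Type u)
      monoHomotopy := fun _ => Iso.refl _
      AnMono := Type u
      κAnMono := CategoryTheory.Equivalence.refl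
      ψAnMono := fun _ _ => 𝟭 (Type u) }
  refine ⟨L₀, ⟨rfl, rfl⟩, ⟨fun M => ?_⟩⟩
  obtain ⟨v⟩ := ‹Nonempty Vmod›
  have f : (PUnit : Type u) ⟶ (PEmpty : Type u) := (M.toE v).hom.app (PUnit : Type u)
  exact (f PUnit.unit).elim

/-- **PRECISION of the rows 6 → 7 datum.**  The add-on's `anToE` — the Def 3.5 (v)(c) edge isomorphism of the
mono-analyticization morphism along `An•[𝒳] → ℰ•` over `An⊢[𝒩⊢⊞] → ℰ⊢` — does NOT imply the Rmk 5.2.2 identification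
`κ₂ ≅ κ_{An•}⁻¹` between the two printed equivalences `ℰ• ≃ An•[𝒳] ≃ ℰ•` (which the frozen interface records as independent
data `κAn`, `κAn₂`): on the sum category `S := Type u ⊕ Type u` take every row `S`, every structure functor `𝟭 S` except
`κ₂ :=` the swap self-equivalence of `S` and the two functors into `ℰ⊢` (`ℰ• → ℰ⊢`, `𝒩⊢_v → ℰ⊢`) constant at `inl ⋆`; then both
add-on squares commute strictly (everything into `ℰ⊢` is constant), while an isomorphism `κ₂.functor ≅ κ_{An•}.inverse = 𝟭`
would have a component `inr ⋆ ⟶ inl ⋆`, of which there is none.  So abc-iut-L4-t15's `hκ` (`κ₂ ⋙ (ℰ• → ℰ⊢) ≅ κ_{An•}⁻¹ ⋙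
(ℰ• → ℰ⊢)`, derived from `anToE` by `anToE'`) is exactly as strong as the add-on, and strictly weaker than Rmk 5.2.2.
[cite: MochizukiAbsTopIII2015, Cor 5.10 p. 146] -/
theorem exists_monoAnalyticizationHomotopies_not_rmk522 :
    ∃ L : LogFrobeniusSetting Vmod isArc,
      Nonempty L.MonoAnalyticizationHomotopies ∧ IsEmpty (L.κAn₂.functor ≅ L.κAn.inverse) := by
  let S : Type (u + 1) := Type u ⊕ Type u
  let c : S := Sum.inl (PUnit : Type u)
  let L₀ : LogFrobeniusSetting Vmod isArc :=
    { X := S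
      E := S
      proj := 𝟭 S
      log := 𝟭 S
      logIsoId := Iso.refl _
      logOver := Iso.refl _
      Nplus := fun _ => S
      N := fun _ => S
      forget := fun _ => 𝟭 S
      toE := fun _ => 𝟭 S
      lam := fun _ _ => 𝟭 S
      lamOver := fun _ _ => Iso.refl _
      lam_spaceLink_eq_postLog := fun _ => rfl
      iota := fun _ ν₁ _ _ => eqToHom (frobeniusTwist_id_comp_id₃ ν₁.isPostLog)
      An := S
      κAn := CategoryTheory.Equivalence.refl
      φAn := 𝟭 S
      φAn_isEquivalence := inferInstance
      ηAn := Iso.refl _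
      κAn₂ := Sum.Swap.equivalence (Type u) (Type u)
      Emono := S
      monoAn := (Functor.const S).obj c
      NmonoPlus := fun _ => S
      Nmono := fun _ => S
      forgetMono := fun _ => 𝟭 S
      toEmono := fun _ => (Functor.const S).obj c
      monoNplus := fun _ => 𝟭 S
      monoN := fun _ => 𝟭 S
      monoHomotopy := fun _ => Iso.refl _
      AnMono := S
      κAnMono := CategoryTheory.Equivalence.refl
      ψAnMono := fun _ _ => 𝟭 S }
  let M₀ : L₀.MonoAnalyticizationHomotopies :=
    { toE := fun _ => Iso.refl _
      anToE := NatIso.ofComponents (fun _ => Iso.refl c) (fun _ => rfl) }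
  refine ⟨L₀, ⟨M₀⟩, ⟨fun e => ?_⟩⟩
  have f : (Sum.inr (PUnit : Type u) : S) ⟶ Sum.inl (PUnit : Type u) := e.hom.app c
  cases f

/-- **Calibration summary**: over every nonempty index set `(V(F_mod), arc-flag)`, some log-Frobenius setting carries
mono-analyticization homotopies and satisfies the typed Cor 5.10 (iv)(a), and some log-Frobenius setting carries NONE —
the add-on `MonoAnalyticizationHomotopies` is satisfiable and independent of the interface `LogFrobeniusSetting`.
[cite: MochizukiAbsTopIII2015, Cor 5.10 p. 146] -/
theorem exists_nonempty_and_exists_isEmpty_monoAnalyticizationHomotopies [Nonempty Vmod] :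
    (∃ L : LogFrobeniusSetting Vmod isArc, Nonempty L.MonoAnalyticizationHomotopies ∧ L.Cor510MonoCores) ∧
      ∃ L : LogFrobeniusSetting Vmod isArc, IsEmpty L.MonoAnalyticizationHomotopies := by
  obtain ⟨L, -, hM, hC⟩ := exists_nonempty_monoAnalyticizationHomotopies Vmod isArc (Type u)
  obtain ⟨L', -, hE⟩ := exists_isEmpty_monoAnalyticizationHomotopies Vmod isArc
  exact ⟨⟨L, hM, hC inferInstance⟩, L', hE⟩

/-! ## The exact logical position of the add-on (appended by abc-iut-w6-d036 g3) -/

/-- **The add-on is EQUIVALENT to abc-iut-L4-t15's two homotopy inputs.**  A log-Frobenius setting carries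
mono-analyticization homotopies (abc-iut-L4-t3's `MonoAnalyticizationHomotopies`: the rows 4 → 5 square `toE` and the
Def 3.5 (v) rows 6 → 7 edge datum `anToE`) if and only if it satisfies the hypotheses `hN` (rows 4 → 5,
`𝒩_v → 𝒩⊢_v → ℰ⊢ ≅ 𝒩_v → ℰ• → ℰ⊢` at every `v`) and `hκ` (`κ₂ ⋙ (ℰ• → ℰ⊢) ≅ κ_{An•}⁻¹ ⋙ (ℰ• → ℰ⊢)`) of `cor510MonoCores_of`
(`LogFrobeniusMonoCoresProofs`): `→` is `M.toE`, `M.anToE'`; `←` rebuilds `anToE` from `hκ` by cancelling the unit of the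
Prop 5.8 (vii) equivalence `ℰ⊢ ≃ An⊢[𝒩⊢⊞]`.  With `exists_monoAnalyticizationHomotopies_not_rmk522` this pins the rows 6 → 7
datum exactly: as strong as `hκ`, strictly weaker than the Rmk 5.2.2 identification `κ₂ ≅ κ_{An•}⁻¹`.
[cite: MochizukiAbsTopIII2015, Cor 5.10 p. 146] -/
theorem nonempty_monoAnalyticizationHomotopies_iff {Vmod : Type u} {isArc : Vmod → Bool}
    (L : LogFrobeniusSetting Vmod isArc) :
    Nonempty L.MonoAnalyticizationHomotopies ↔
      (∀ v : Vmod, Nonempty (L.monoN v ⋙ L.toEmono v ≅ L.toE v ⋙ L.monoAn)) ∧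
        Nonempty (L.κAn₂.functor ⋙ L.monoAn ≅ L.κAn.inverse ⋙ L.monoAn) := by
  refine ⟨fun ⟨M⟩ => ⟨fun v => ⟨M.toE v⟩, ⟨M.anToE'⟩⟩, fun ⟨hN, ⟨hκ⟩⟩ => ⟨?_⟩⟩
  exact
    { toE := fun v => (hN v).some
      anToE :=
        Functor.associator _ _ _ ≪≫
          Functor.isoWhiskerLeft L.κAn.inverse
            (Functor.associator _ _ _ ≪≫ Functor.isoWhiskerLeft L.monoAn L.κAnMono.unitIso.symm ≪≫
              L.monoAn.rightUnitor) ≪≫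
          hκ.symm }

/-- Hence, over a nonempty index set, **Cor 5.10 (iv)(a) over the add-on and Cor 5.10 (iv)(a) from `hN`, `hκ` are the same
theorem**: `cor510MonoCores_holds` applies exactly where abc-iut-L4-t15's `cor510MonoCores_of` does.
[cite: MochizukiAbsTopIII2015, Cor 5.10 (iv)(a) p. 147] -/
theorem cor510MonoCores_of_iff_inputs {Vmod : Type u} [Nonempty Vmod] {isArc : Vmod → Bool} (L : LogFrobeniusSetting Vmod isArc)
    (hN : ∀ v : Vmod, Nonempty (L.monoN v ⋙ L.toEmono v ≅ L.toE v ⋙ L.monoAn))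
    (hκ : Nonempty (L.κAn₂.functor ⋙ L.monoAn ≅ L.κAn.inverse ⋙ L.monoAn)) :
    Nonempty L.MonoAnalyticizationHomotopies ∧ L.Cor510MonoCores :=
  ⟨(nonempty_monoAnalyticizationHomotopies_iff L).mpr ⟨hN, hκ⟩, L.cor510MonoCores_of hN hκ⟩

end LogFrobeniusSetting

end Literature.AnabelianGeometry.AbsoluteAnabelian
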